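import Mathlib.CategoryTheory.Adjunction.Limits
import Mathlib.CategoryTheory.Limits.Preserves.Shapes.BinaryProducts
import Literature.AlgebraicGeometry.Frobenioids.CoproductCompletionConnected
import Literature.AlgebraicGeometry.Frobenioids.DissectionEquivalenceTransport
import HarnessLib

/-!
# Frobenioids I, §0 (pp. 14–15): the "types" of categories and the connectedness vocabulary are
# invariant under equivalences of categories

Mochizuki, *The geometry of Frobenioids I: the general theory*, Kyushu J. Math. **62** (2008)
293–400, §0 "Notations and Conventions", paragraph **Categories**, kurims text pp. 14–15
[cite: MochizukiFrdI2008, §0 pp.14-15]: "a category of FSM-type" (p. 14 l. 14), "`Aut`-saturated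
(respectively, `Aut^sub`-saturated; of `Aut`-type)" objects and categories (p. 14 ll. 24–29), "mobile",
"connected", "quasi-connected" objects and "totally (respectively, almost totally) epimorphic"
categories (p. 15 ll. 18–23) — typed in `Categories.lean` (abc-iut-L1-t1).  These are the standing
hypotheses on base categories throughout [FrdI], [FrdII], [EtTh] §3–§5 and [IUTchI] ("`D` connected,
totally epimorphic, of FSM-type …"), and the paper treats them as properties of the category up to
equivalence (cf. the proof of Thm. 3.4, p. 63: the §0 notions are "manifestly preserved by any
equivalence of categories").

Companion of `EquivalenceTransport.lean` (arrow classes of [FrdI] §0) and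
`DissectionEquivalenceTransport.lean` ([FrdII] §0 p. 5).  PROOF-ONLY (no definitions, no instances).
For an equivalence `e : C ≌ D`:

* `isTotallyEpimorphic_iff_of_equivalence`, `isAlmostTotallyEpimorphic_iff_of_equivalence`
  (a faithful functor reflects epimorphisms);
* `isOfFSMType_iff_of_equivalence` (FSM-morphisms are preserved, isomorphisms reflected);
* `IsSubAutomorphism.map_equivalence` / `.of_map_equivalence`, `isOfAutTypeObj_map_equivalence_iff`,
  `isAutSaturatedObj_map_equivalence_iff`, `isAutSubSaturatedObj_map_equivalence_iff` and the three
  category-level statements `isOfAutType_iff_of_equivalence`, `isAutSaturated_iff_of_equivalence`,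
  `isAutSubSaturated_iff_of_equivalence`;
* `isMobile_map_equivalence_iff`, `isConnectedObj_map_equivalence_iff` (an equivalence preserves and
  reflects binary coproduct diagrams), `isQuasiConnected_map_equivalence_iff`.

Elementary category theory over Mathlib (`Functor.epi_of_epi_map`,
`mapIsColimitOfPreservesOfIsColimit`); nothing here bears on the disputed [IUTchIII] Cor. 3.12 or
takes a side; no FACT-LIST row is asserted (abc-iut cell, seat abc-iut-f-031, by-product).
-/

namespace Literature.AlgebraicGeometry.Frobenioids

open CategoryTheory CategoryTheory.Limits

universe v₁ v₂ u₁ u₂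

variable {C : Type u₁} [Category.{v₁} C] {D : Type u₂} [Category.{v₂} D] (e : C ≌ D)

/-! ### Totally and almost totally epimorphic categories (p. 15) -/

/-- A category equivalent to a totally epimorphic one is totally epimorphic (`e⁻¹` is faithful, hence
reflects epimorphisms). [cite: MochizukiFrdI2008, §0 p.15] -/
theorem IsTotallyEpimorphic.of_equivalence (e : C ≌ D) (h : IsTotallyEpimorphic C) :
    IsTotallyEpimorphic D :=
  ⟨fun _ => e.inverse.epi_of_epi_map (h.epi _)⟩

/-- Being totally epimorphic is invariant under equivalence. [cite: MochizukiFrdI2008, §0 p.15] -/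
theorem isTotallyEpimorphic_iff_of_equivalence (e : C ≌ D) :
    IsTotallyEpimorphic C ↔ IsTotallyEpimorphic D :=
  ⟨fun h => h.of_equivalence e, fun h => h.of_equivalence e.symm⟩

/-! ### Categories of FSM-type (p. 14) -/

/-- A category equivalent to one of FSM-type is of FSM-type: an FSM-morphism `f'` of `D` has FSM image
`e⁻¹(f')` (`IsFSM.map_equivalence`), an isomorphism, and `e⁻¹` reflects isomorphisms.
[cite: MochizukiFrdI2008, §0 p.14] -/
theorem IsOfFSMType.of_equivalence (e : C ≌ D) (h : IsOfFSMType C) : IsOfFSMType D :=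
  ⟨fun f' hf' => isIso_of_map_isIso_equivalence e.symm f'
    (h.isIso_of_isFSM _ (hf'.map_equivalence e.symm))⟩

/-- Being of FSM-type is invariant under equivalence. [cite: MochizukiFrdI2008, §0 p.14] -/
theorem isOfFSMType_iff_of_equivalence (e : C ≌ D) : IsOfFSMType C ↔ IsOfFSMType D :=
  ⟨fun h => h.of_equivalence e, fun h => h.of_equivalence e.symm⟩

/-! ### Sub-automorphisms; `Aut`-saturated, `Aut^sub`-saturated, `Aut`-type (p. 14) -/

/-- An equivalence carries sub-automorphisms to sub-automorphisms (`e(β) ∘? e(φ) = e(φ) ∘ e(α)`).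
[cite: MochizukiFrdI2008, §0 p.14] -/
theorem IsSubAutomorphism.map_equivalence {A : C} {α : A ⟶ A} (h : IsSubAutomorphism α) :
    IsSubAutomorphism (e.functor.map α) := by
  obtain ⟨B, φ, β, hβ⟩ := h
  exact ⟨e.functor.obj B, e.functor.map φ, e.functor.mapIso β, by
    rw [Functor.mapIso_hom, ← Functor.map_comp, hβ, Functor.map_comp]⟩

/-- Conversely, if `e(α)` is a sub-automorphism (`β' ∘? φ' = φ' ∘ e(α)` with `φ' : B' → e(A)`), then so is
`α`: pull `φ'`, `β'` back along `e(e⁻¹B') ≅ B'`. [cite: MochizukiFrdI2008, §0 p.14] -/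
theorem IsSubAutomorphism.of_map_equivalence {A : C} {α : A ⟶ A}
    (h : IsSubAutomorphism (e.functor.map α)) : IsSubAutomorphism α := by
  obtain ⟨B', φ', β', hβ'⟩ := h
  obtain ⟨φ, hφ⟩ := exists_preimage_to e φ'
  refine ⟨e.functor.objPreimage B', φ,
    e.functor.preimageIso
      (e.functor.objObjPreimageIso B' ≪≫ β' ≪≫ (e.functor.objObjPreimageIso B').symm),
    e.functor.map_injective ?_⟩
  simp only [Functor.map_comp, Functor.preimageIso_hom, Functor.map_preimage, Iso.trans_hom,
    Iso.symm_hom, hφ, Category.assoc, Iso.inv_hom_id_assoc, hβ']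

/-- `e(α)` is a sub-automorphism iff `α` is. [cite: MochizukiFrdI2008, §0 p.14] -/
theorem isSubAutomorphism_map_equivalence_iff {A : C} (α : A ⟶ A) :
    IsSubAutomorphism (e.functor.map α) ↔ IsSubAutomorphism α :=
  ⟨fun h => h.of_map_equivalence e, fun h => h.map_equivalence e⟩

/-- `e(A)` is of `Aut`-type iff `A` is (every endomorphism of `e(A)` is the image of one of `A`, and `e`
preserves and reflects isomorphisms). [cite: MochizukiFrdI2008, §0 p.14] -/
theorem isOfAutTypeObj_map_equivalence_iff (A : C) :
    IsOfAutTypeObj (e.functor.obj A) ↔ IsOfAutTypeObj A := by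
  refine ⟨fun h α => isIso_of_map_isIso_equivalence e α (h _), fun h α' => ?_⟩
  rw [← e.functor.map_preimage α']
  haveI := h (e.functor.preimage α')
  infer_instance

/-- `e(A)` is `Aut`-saturated iff `A` is. [cite: MochizukiFrdI2008, §0 p.14] -/
theorem isAutSaturatedObj_map_equivalence_iff (A : C) :
    IsAutSaturatedObj (e.functor.obj A) ↔ IsAutSaturatedObj A := by
  refine ⟨fun h α hα => isIso_of_map_isIso_equivalence e α (h _ (hα.map_equivalence e)),
    fun h α' hα' => ?_⟩
  rw [← e.functor.map_preimage α'] at hα' ⊢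
  haveI := h _ (hα'.of_map_equivalence e)
  infer_instance

/-- `e(A)` is `Aut^sub`-saturated iff `A` is. [cite: MochizukiFrdI2008, §0 p.14] -/
theorem isAutSubSaturatedObj_map_equivalence_iff (A : C) :
    IsAutSubSaturatedObj (e.functor.obj A) ↔ IsAutSubSaturatedObj A := by
  refine ⟨fun h α => (h (e.functor.map α)).of_map_equivalence e, fun h α' => ?_⟩
  rw [← e.functor.map_preimage α']
  exact (h _).map_equivalence e

/-- A category equivalent to one of `Aut`-type is of `Aut`-type. [cite: MochizukiFrdI2008, §0 p.14] -/
theorem IsOfAutType.of_equivalence (e : C ≌ D) (h : IsOfAutType C) : IsOfAutType D :=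
  ⟨fun A' => (isOfAutTypeObj_map_equivalence_iff e.symm A').mp (h.obj _)⟩

/-- Being of `Aut`-type is invariant under equivalence. [cite: MochizukiFrdI2008, §0 p.14] -/
theorem isOfAutType_iff_of_equivalence (e : C ≌ D) : IsOfAutType C ↔ IsOfAutType D :=
  ⟨fun h => h.of_equivalence e, fun h => h.of_equivalence e.symm⟩

/-- A category equivalent to an `Aut`-saturated one is `Aut`-saturated.
[cite: MochizukiFrdI2008, §0 p.14] -/
theorem IsAutSaturated.of_equivalence (e : C ≌ D) (h : IsAutSaturated C) : IsAutSaturated D :=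
  ⟨fun A' => (isAutSaturatedObj_map_equivalence_iff e.symm A').mp (h.obj _)⟩

/-- Being `Aut`-saturated is invariant under equivalence. [cite: MochizukiFrdI2008, §0 p.14] -/
theorem isAutSaturated_iff_of_equivalence (e : C ≌ D) : IsAutSaturated C ↔ IsAutSaturated D :=
  ⟨fun h => h.of_equivalence e, fun h => h.of_equivalence e.symm⟩

/-- A category equivalent to an `Aut^sub`-saturated one is `Aut^sub`-saturated.
[cite: MochizukiFrdI2008, §0 p.14] -/
theorem IsAutSubSaturated.of_equivalence (e : C ≌ D) (h : IsAutSubSaturated C) :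
    IsAutSubSaturated D :=
  ⟨fun A' => (isAutSubSaturatedObj_map_equivalence_iff e.symm A').mp (h.obj _)⟩

/-- Being `Aut^sub`-saturated is invariant under equivalence. [cite: MochizukiFrdI2008, §0 p.14] -/
theorem isAutSubSaturated_iff_of_equivalence (e : C ≌ D) :
    IsAutSubSaturated C ↔ IsAutSubSaturated D :=
  ⟨fun h => h.of_equivalence e, fun h => h.of_equivalence e.symm⟩

/-! ### Mobile, connected and quasi-connected objects (p. 15) -/

/-- `e` carries mobile objects to mobile objects (faithfulness). [cite: MochizukiFrdI2008, §0 p.15] -/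
theorem IsMobile.map_equivalence {A : C} (h : IsMobile A) : IsMobile (e.functor.obj A) := by
  obtain ⟨B, f, g, hfg⟩ := h
  exact ⟨e.functor.obj B, e.functor.map f, e.functor.map g, fun h' => hfg (e.functor.map_injective h')⟩

/-- If `e(A)` is mobile then so is `A` (pull two distinct arrows `e(A) ⇉ B'` back along `e(e⁻¹B') ≅ B'`).
[cite: MochizukiFrdI2008, §0 p.15] -/
theorem IsMobile.of_map_equivalence {A : C} (h : IsMobile (e.functor.obj A)) : IsMobile A := by
  obtain ⟨B', f', g', hfg⟩ := h
  obtain ⟨f, hf⟩ := exists_preimage_from e f'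
  obtain ⟨g, hg⟩ := exists_preimage_from e g'
  refine ⟨_, f, g, fun hfg' => hfg ?_⟩
  have h' := congrArg e.functor.map hfg'
  rw [hf, hg] at h'
  exact (cancel_mono _).mp h'

/-- `e(A)` is mobile iff `A` is. [cite: MochizukiFrdI2008, §0 p.15] -/
theorem isMobile_map_equivalence_iff (A : C) : IsMobile (e.functor.obj A) ↔ IsMobile A :=
  ⟨fun h => h.of_map_equivalence e, fun h => h.map_equivalence e⟩

/-- If `e(A)` is connected then so is `A`: a coproduct diagram `B₁ → A ← B₂` with non-initial `Bᵢ` is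
carried by `e` (which preserves colimits) to one for `e(A)`. [cite: MochizukiFrdI2008, §0 p.15] -/
theorem IsConnectedObj.of_map_equivalence {A : C} (h : IsConnectedObj (e.functor.obj A)) :
    IsConnectedObj A := by
  refine ⟨h.1.of_map_equivalence e, fun B₁ B₂ ι₁ ι₂ hB₁ hB₂ => ⟨fun hc => ?_⟩⟩
  exact (h.2 _ _ (e.functor.map ι₁) (e.functor.map ι₂) (hB₁.map_equivalence e)
    (hB₂.map_equivalence e)).false (mapIsColimitOfPreservesOfIsColimit e.functor ι₁ ι₂ hc)

/-- `e` carries connected objects to connected objects: a coproduct diagram `B₁' → e(A) ← B₂'` is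
carried by `e⁻¹` to one for `e⁻¹e(A) ≅ A`. [cite: MochizukiFrdI2008, §0 p.15] -/
theorem IsConnectedObj.map_equivalence {A : C} (h : IsConnectedObj A) :
    IsConnectedObj (e.functor.obj A) := by
  refine ⟨h.1.map_equivalence e, fun B₁' B₂' ι₁' ι₂' hB₁ hB₂ => ⟨fun hc => ?_⟩⟩
  have h' : IsConnectedObj (e.inverse.obj (e.functor.obj A)) := h.of_iso (e.unitIso.app A)
  exact (h'.2 _ _ (e.inverse.map ι₁') (e.inverse.map ι₂') (hB₁.map_equivalence e.symm)
    (hB₂.map_equivalence e.symm)).false (mapIsColimitOfPreservesOfIsColimit e.inverse ι₁' ι₂' hc)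

/-- `e(A)` is connected iff `A` is. [cite: MochizukiFrdI2008, §0 p.15] -/
theorem isConnectedObj_map_equivalence_iff (A : C) :
    IsConnectedObj (e.functor.obj A) ↔ IsConnectedObj A :=
  ⟨fun h => h.of_map_equivalence e, fun h => h.map_equivalence e⟩

/-- `e(A)` is quasi-connected iff `A` is. [cite: MochizukiFrdI2008, §0 p.15] -/
theorem isQuasiConnected_map_equivalence_iff (A : C) :
    IsQuasiConnected (e.functor.obj A) ↔ IsQuasiConnected A :=
  or_congr (not_congr (isMobile_map_equivalence_iff e A)) (isConnectedObj_map_equivalence_iff e A)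

/-- A category equivalent to an almost totally epimorphic one is almost totally epimorphic
(non-initiality and connectedness of the ends transported along `e⁻¹`).
[cite: MochizukiFrdI2008, §0 p.15] -/
theorem IsAlmostTotallyEpimorphic.of_equivalence (e : C ≌ D) (h : IsAlmostTotallyEpimorphic C) :
    IsAlmostTotallyEpimorphic D :=
  ⟨fun _ hA' hB' => e.inverse.epi_of_epi_map
    (h.epi _ (hA'.map_equivalence e.symm) (hB'.map_equivalence e.symm))⟩

/-- Being almost totally epimorphic is invariant under equivalence. [cite: MochizukiFrdI2008, §0 p.15] -/
theorem isAlmostTotallyEpimorphic_iff_of_equivalence (e : C ≌ D) :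
    IsAlmostTotallyEpimorphic C ↔ IsAlmostTotallyEpimorphic D :=
  ⟨fun h => h.of_equivalence e, fun h => h.of_equivalence e.symm⟩

/-! ### Connected categories (p. 16) -/

/-- A category equivalent to a connected one (its graph `G(C)` is connected, [FrdI] §0 p. 16) is
connected — through `isGraphConnected_iff_isConnected` this is Mathlib's `isConnected_of_equivalent`.
[cite: MochizukiFrdI2008, §0 p.16] -/
theorem IsGraphConnected.of_equivalence (e : C ≌ D) (h : IsGraphConnected C) : IsGraphConnected D := by
  haveI := isGraphConnected_iff_isConnected.mp h
  exact isGraphConnected_iff_isConnected.mpr (isConnected_of_equivalent e)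

/-- Connectedness of a category is invariant under equivalence. [cite: MochizukiFrdI2008, §0 p.16] -/
theorem isGraphConnected_iff_of_equivalence (e : C ≌ D) : IsGraphConnected C ↔ IsGraphConnected D :=
  ⟨fun h => h.of_equivalence e, fun h => h.of_equivalence e.symm⟩

end Literature.AlgebraicGeometry.Frobenioids
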